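import Mathlib
import Literature.NumberTheory.Transcendental.KZCubeRational
import Summits.KontsevichZagierPeriods.KontsevichZagierPeriods.Theorems.ScissorsTransportPolytopeTransportPoly
import Summits.KontsevichZagierPeriods.KontsevichZagierPeriods.Theorems.InverseLandauTateFamilyKernelOpenCube

/-!
# Crux `TateFamilyKernel` (stmt-KontsevichZagierPeriods-9130), line `Sketch` — stub `stub_sfExact`

SYMMETRIC-FOLD LINEAR CLASS of the lead's skeleton (dimension `2`,
`Q = 1 − ϖ·z₁(1−z₁)·(α + βz₂)`, `0 < α`, `0 < β`, `P` free of `ϖ`): Griffiths exactness AT THE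
FIBRE `ϖ₀ > 0`. Write `x = z₁ = X 0`, `s = z₂ = X 1`, `ϖ = X (Fin.last 2)`, `u = x(1−x)`,
`u' = 1 − 2x`, `W = α + βs`, `Q = 1 − ϖuW`. The log-elimination step (`stub_sfLogElim`) hands over
`k : ℕ` and `R ∈ ℚ[y, x]` with `d/dx (R(y,x)/u^k) = P(x, s_y(x))/u`, `s_y(x) = (y/u − α)/β`, i.e. a
rational `x`-primitive along the level curve `Z_y : uW = y`.

The certificate (three Griffiths terms, `ℚ`-polynomial data in `(x, s, ϖ)`, proved for EVERY real
`ϖ ≠ 0` and then evaluated at `ϖ₀`):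
* the REVERSAL `R̂(x, ϖ) = ϖ^{N₁} R(1/ϖ, x)` (`SfExact.xrev`) and the polynomial
  `Γ = R̂ · (ϖW)^k`; on the polar curve `Z = {Q = 0} = {uW = 1/ϖ}` one has `ϖW = 1/u`, so
  `Γ|_Z = ϖ^{N₁} R(1/ϖ, x)/u^k`, whose `x`-derivative along `Z` is `ϖ^{N₁} P/u` (the datum at
  `y = 1/ϖ`); by the chain rule and `s_y' = −∂ₓQ/∂ₛQ` this says that the Jacobian
  `Jac(Γ, Q) = ∂ₓΓ∂ₛQ − ∂ₛΓ∂ₓQ` equals `∂ₛQ · ϖ^{N₁}P/u = −βϖ^{N₁+1} P` on `Z`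
  (KEY FACT, `HasDerivAt.unique`); so `H := Jac(Γ, Q) + βϖ^{N₁+1}P` vanishes on `Z`;
* DIVISION: `Q = 1 − ϖ·(uW)` is linear in `ϖ`, so `(uW)^N H = q·Q + Rm` with `Rm` free of `ϖ`
  (`SfExact.div_rem_update`); evaluating at the polar point `ϖ = 1/(uW)` gives `Rm = 0` on a box
  with infinite sides, hence `Rm = 0` (`MvPolynomial.funext_set`); and since `Q ≡ 1 (mod ϖuW)` the
  geometric sum turns `(uW)^N H = qQ` into an honest factorisation `H = Q·p`
  (`SfExact.exists_eq_mul_of_pow_mul`) — no denominators `u` (which vanish on the boundary);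
* the IDENTITY `P/Q = p/c − Jac(Γ,Q)/(cQ)`, `c = βϖ^{N₁+1}`, with
  `Jac(Γ,Q)/Q = ∂ₓ(Γ∂ₛQ/Q) − ∂ₛ(Γ∂ₓQ/Q)` and `p = ∂ₓ(antider p)`: the data are
  `A = (antider p, βϖuΓ, −ϖu'WΓ)` along `(x, x, s)` over `D = (c, cQ, cQ)`, nonvanishing on the
  closed square at `ϖ₀ > 0` by the hypothesis on `Q`.
The verification is symbolic differentiation (`pderiv`), evaluation, and one rational identity.
The hypothesis `IsAlgebraic ℚ ϖ₀` of the registered signature is not needed (the identity holds at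
every real `ϖ₀ > 0` with `Q(·, ϖ₀) ≠ 0` on the square). No named fact, no new definition.
References: Kontsevich–Zagier 2001 §1.2 (rule (3), Stokes); Griffiths 1969 (reduction of pole
order).
-/

noncomputable section

open MeasureTheory Set MvPolynomial
open Literature.NumberTheory.Transcendental
open Summit.KontsevichZagierPeriods.ScissorsTransport.PolytopeTransport (antider pderiv_antider)

namespace Summit.KontsevichZagierPeriods.InverseLandau.TateFamilyKernel.Descent

namespace SfExact

/-- **Division with remainder by `1 − Xᵢ·U` in the variable `Xᵢ`** (any variable `i`). If `U` does
not involve `Xᵢ` (in evaluation), then for every `P` there are `N`, `q` and an `Xᵢ`-free `R` with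
`U^N · P = q · (1 − Xᵢ U) + R`. [folklore] -/
theorem div_rem_update {n : ℕ} (i : Fin n) (U : MvPolynomial (Fin n) ℚ)
    (hU : ∀ (f : Fin n → ℝ) (t : ℝ), aeval (Function.update f i t) U = aeval f U)
    (P : MvPolynomial (Fin n) ℚ) :
    ∃ (N : ℕ) (q R : MvPolynomial (Fin n) ℚ), U ^ N * P = q * (1 - X i * U) + R ∧
      ∀ (f : Fin n → ℝ) (t : ℝ), aeval (Function.update f i t) R = aeval f R := by
  -- adapted from `LinExactW.div_rem` (variable `0`) of …StubLinExactW.lean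
  induction P using MvPolynomial.induction_on with
  | C a => exact ⟨0, 0, C a, by ring, fun f t => by simp⟩
  | add p₁ p₂ h₁ h₂ =>
    obtain ⟨N₁, q₁, R₁, h₁, hR₁⟩ := h₁
    obtain ⟨N₂, q₂, R₂, h₂, hR₂⟩ := h₂
    refine ⟨N₁ + N₂, U ^ N₂ * q₁ + U ^ N₁ * q₂, U ^ N₂ * R₁ + U ^ N₁ * R₂, ?_, fun f t => ?_⟩
    · linear_combination U ^ N₂ * h₁ + U ^ N₁ * h₂
    · simp only [map_add, map_mul, map_pow, hU, hR₁, hR₂]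
  | mul_X p j h =>
    obtain ⟨N, q, R, h, hR⟩ := h
    by_cases hj : j = i
    · subst hj
      exact ⟨N + 1, X j * U * q - R, R, by linear_combination (X j * U) * h, hR⟩
    · refine ⟨N, q * X j, R * X j, by linear_combination (X j) * h, fun f t => ?_⟩
      simp only [map_mul, aeval_X, hR, Function.update_of_ne hj]

/-- **From `U^N · P = q · (1 − XᵢU)` to `(1 − XᵢU) ∣ P`**: `1 − XᵢU` is a unit modulo `(XᵢU)^N`
(geometric sum), so `P = (1 − XᵢU)·(P·Σ_{m<N}(XᵢU)^m + Xᵢ^N q)`. [folklore] -/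
theorem exists_eq_mul_of_pow_mul {n : ℕ} (i : Fin n) (U P q : MvPolynomial (Fin n) ℚ) (N : ℕ)
    (h : U ^ N * P = q * (1 - X i * U)) :
    ∃ p : MvPolynomial (Fin n) ℚ, P = (1 - X i * U) * p :=
  ⟨P * ∑ m ∈ Finset.range N, (X i * U) ^ m + X i ^ N * q, by
    linear_combination (-P) * mul_neg_geom_sum (X i * U) N + X i ^ N * h⟩

/-- **Reversal in the first variable, output along `X 0`.** For `R ∈ ℚ[y, x]` there are `N` and
`R̂ ∈ ℚ[x, s, ϖ]` with `R̂(x, s, ϖ) = ϖ^N · R(1/ϖ, x)` at every real point with `ϖ ≠ 0`.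
[folklore] -/
theorem xrev (R : MvPolynomial (Fin 2) ℚ) :
    ∃ (N : ℕ) (Rr : MvPolynomial (Fin (2 + 1)) ℚ), ∀ f : Fin (2 + 1) → ℝ, f (Fin.last 2) ≠ 0 →
      aeval f Rr = f (Fin.last 2) ^ N * aeval ![(f (Fin.last 2))⁻¹, f 0] R := by
  -- adapted from `LinExactW.yrev` (output along `X 1`) of …StubLinExactW.lean
  induction R using MvPolynomial.induction_on with
  | C a => exact ⟨0, C a, fun f _ => by simp⟩
  | add p₁ p₂ h₁ h₂ =>
    obtain ⟨N₁, R₁, h₁⟩ := h₁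
    obtain ⟨N₂, R₂, h₂⟩ := h₂
    refine ⟨N₁ + N₂, X (Fin.last 2) ^ N₂ * R₁ + X (Fin.last 2) ^ N₁ * R₂, fun f hf => ?_⟩
    rw [map_add, map_mul, map_mul, map_pow, map_pow, aeval_X, h₁ f hf, h₂ f hf, map_add]
    ring
  | mul_X p i h =>
    obtain ⟨N, R, h⟩ := h
    fin_cases i
    · refine ⟨N + 1, R, fun f hf => ?_⟩
      rw [h f hf]
      simp only [Fin.zero_eta, map_mul, aeval_X, Matrix.cons_val_zero]
      rw [pow_succ]
      field_simp
    · refine ⟨N, R * X 0, fun f hf => ?_⟩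
      simp only [Fin.mk_one, map_mul, aeval_X, Matrix.cons_val_one, Matrix.cons_val_fin_one, h f hf]
      ring

end SfExact

open SfExact in
/-- **Symmetric-fold class, exactness at the fibre** (stub `stub_sfExact` of the crux
`TateFamilyKernel`, line `Sketch`). For `Q = 1 − ϖ z₁(1−z₁)(α + βz₂)` with `0 < α`, `0 < β`, a
`ϖ`-free `P`, and a rational `x`-primitive `R(y,x)/(x(1−x))^k` of `x ↦ P(x, s_y(x))/(x(1−x))`,
`s_y(x) = (y/(x(1−x)) − α)/β` (i.e. along the level curve `Z_y`), the fibre `P/Q(·, ϖ₀)` at `ϖ₀ > 0`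
is Griffiths-exact on the closed square with `ℚ`-polynomial data regular there:
`P/Q = ∂_{z₁}(antider p / c) + ∂_{z₁}(βϖuΓ/(cQ)) + ∂_{z₂}(−ϖu'WΓ/(cQ))` at `ϖ₀`, where
`Γ = ϖ^{N₁}R(1/ϖ, z₁)·(ϖW)^k`, `c = βϖ^{N₁+1}`, and `p` is the quotient of
`Jac(Γ, Q) + c·P` by `Q` (the dlog certificate: `Jac(Γ,Q) = −cP` on the polar curve `Q = 0`).
[cite: KontsevichZagier2001, §1.2] -/
theorem stub_sfExact (α β : ℚ) (P : MvPolynomial (Fin 2) ℚ) (hα : 0 < α) (hβ : 0 < β)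
    (k : ℕ) (R : MvPolynomial (Fin 2) ℚ)
    (hR : ∀ (y x : ℝ), x ≠ 0 → x ≠ 1 →
      HasDerivAt (fun x' : ℝ => aeval ![y, x'] R / (x' * (1 - x')) ^ k)
        (aeval ![x, (y / (x * (1 - x)) - α) / β] P / (x * (1 - x))) x)
    (ϖ₀ : ℝ) (halg : IsAlgebraic ℚ ϖ₀) (hϖ₀ : 0 < ϖ₀)
    (hQ : ∀ w ∈ KZ.cube 2, aeval (Fin.snoc w ϖ₀ : Fin (2 + 1) → ℝ)
      (1 - X (Fin.last 2) * (X 0 * (1 - X 0)) * (C α + C β * X 1) : MvPolynomial (Fin (2 + 1)) ℚ) ≠ 0) :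
    ∃ (K : ℕ) (i : Fin K → Fin 2) (A Dn : Fin K → MvPolynomial (Fin (2 + 1)) ℚ),
      (∀ k, ∀ w ∈ KZ.cube 2, aeval (Fin.snoc w ϖ₀ : Fin (2 + 1) → ℝ) (Dn k) ≠ 0) ∧
      (∀ w ∈ KZ.cube 2,
        aeval (Fin.snoc w ϖ₀ : Fin (2 + 1) → ℝ) (rename Fin.castSucc P) /
            aeval (Fin.snoc w ϖ₀ : Fin (2 + 1) → ℝ)
              (1 - X (Fin.last 2) * (X 0 * (1 - X 0)) * (C α + C β * X 1) : MvPolynomial (Fin (2 + 1)) ℚ) =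
          ∑ k, aeval (Fin.snoc w ϖ₀ : Fin (2 + 1) → ℝ)
              (pderiv (Fin.castSucc (i k)) (A k) * Dn k - A k * pderiv (Fin.castSucc (i k)) (Dn k)) /
            aeval (Fin.snoc w ϖ₀ : Fin (2 + 1) → ℝ) (Dn k ^ 2)) := by
  have _ := halg
  have hαr : (0 : ℝ) < α := by exact_mod_cast hα
  have hβr : (β : ℝ) ≠ 0 := by exact_mod_cast hβ.ne'
  have hp0 : ϖ₀ ≠ 0 := hϖ₀.ne'
  -- the polynomial data (`X 0 = z₁ = x`, `X 1 = z₂ = s`, `X (Fin.last 2) = ϖ`)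
  obtain ⟨W, hW⟩ : ∃ W : MvPolynomial (Fin (2 + 1)) ℚ, W = C α + C β * X 1 := ⟨_, rfl⟩
  obtain ⟨u, hu⟩ : ∃ u : MvPolynomial (Fin (2 + 1)) ℚ, u = X 0 * (1 - X 0) := ⟨_, rfl⟩
  obtain ⟨u', hu'⟩ : ∃ u' : MvPolynomial (Fin (2 + 1)) ℚ, u' = 1 - X 0 - X 0 := ⟨_, rfl⟩
  obtain ⟨Qp, hQp⟩ : ∃ Qp : MvPolynomial (Fin (2 + 1)) ℚ, Qp = 1 - X (Fin.last 2) * u * W :=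
    ⟨_, rfl⟩
  have hQp' : (1 - X (Fin.last 2) * (X 0 * (1 - X 0)) * (C α + C β * X 1) :
      MvPolynomial (Fin (2 + 1)) ℚ) = Qp := by rw [hQp, hu, hW]
  rw [hQp'] at hQ ⊢
  obtain ⟨N₁, Rr, hRr⟩ := xrev R
  obtain ⟨Γ, hΓ⟩ : ∃ Γ : MvPolynomial (Fin (2 + 1)) ℚ, Γ = Rr * (X (Fin.last 2) * W) ^ k :=
    ⟨_, rfl⟩
  obtain ⟨c, hc⟩ : ∃ c : MvPolynomial (Fin (2 + 1)) ℚ, c = C β * X (Fin.last 2) ^ (N₁ + 1) :=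
    ⟨_, rfl⟩
  obtain ⟨H, hH⟩ : ∃ H : MvPolynomial (Fin (2 + 1)) ℚ,
      H = pderiv 0 Γ * pderiv 1 Qp - pderiv 1 Γ * pderiv 0 Qp + c * rename Fin.castSucc P :=
    ⟨_, rfl⟩
  -- symbolic partial derivatives
  have h10 : (1 : Fin (2 + 1)) ≠ 0 := by decide
  have hL0 : (Fin.last 2 : Fin (2 + 1)) ≠ 0 := by decide
  have hL1 : (Fin.last 2 : Fin (2 + 1)) ≠ 1 := by decide
  have hW1 : pderiv 1 W = C β := by
    rw [hW, map_add, pderiv_C, pderiv_mul, pderiv_C, pderiv_X_self]; ring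
  have hW0 : pderiv 0 W = 0 := by
    rw [hW, map_add, pderiv_C, pderiv_mul, pderiv_C, pderiv_X_of_ne h10]; ring
  have hu0 : pderiv 0 u = u' := by
    rw [hu, hu', pderiv_mul, map_sub, pderiv_one, pderiv_X_self]; ring
  have hu1 : pderiv 1 u = 0 := by
    rw [hu, pderiv_mul, map_sub, pderiv_one, pderiv_X_of_ne h10.symm]; ring
  have hu'1 : pderiv 1 u' = 0 := by
    rw [hu', map_sub, map_sub, pderiv_one, pderiv_X_of_ne h10.symm]; ring
  have hQ0 : pderiv 0 Qp = -(X (Fin.last 2) * u' * W) := by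
    rw [hQp, map_sub, pderiv_one, pderiv_mul, pderiv_mul, pderiv_X_of_ne hL0, hu0, hW0]; ring
  have hQ1 : pderiv 1 Qp = -(X (Fin.last 2) * u * C β) := by
    rw [hQp, map_sub, pderiv_one, pderiv_mul, pderiv_mul, pderiv_X_of_ne hL1, hu1, hW1]; ring
  have hc0 : pderiv 0 c = 0 := by
    rw [hc, pderiv_C_mul, pderiv_pow, pderiv_X_of_ne hL0]; ring
  have hc1 : pderiv 1 c = 0 := by
    rw [hc, pderiv_C_mul, pderiv_pow, pderiv_X_of_ne hL1]; ring
  -- evaluation of the data at real points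
  have heW : ∀ f : Fin (2 + 1) → ℝ, aeval f W = α + β * f 1 := fun f => by simp [hW]
  have heu : ∀ f : Fin (2 + 1) → ℝ, aeval f u = f 0 * (1 - f 0) := fun f => by simp [hu]
  have heu' : ∀ f : Fin (2 + 1) → ℝ, aeval f u' = 1 - f 0 - f 0 := fun f => by simp [hu']
  have heQ : ∀ f : Fin (2 + 1) → ℝ,
      aeval f Qp = 1 - f (Fin.last 2) * (f 0 * (1 - f 0)) * (α + β * f 1) := fun f => by
    rw [hQp, map_sub, map_one, map_mul, map_mul, aeval_X, heu, heW]
  have hec : ∀ f : Fin (2 + 1) → ℝ, aeval f c = β * f (Fin.last 2) ^ (N₁ + 1) := fun f => by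
    simp [hc]
  have heΓ : ∀ f : Fin (2 + 1) → ℝ, f (Fin.last 2) ≠ 0 → aeval f Γ =
      f (Fin.last 2) ^ N₁ * aeval ![(f (Fin.last 2))⁻¹, f 0] R *
        (f (Fin.last 2) * (α + β * f 1)) ^ k := fun f hf => by
    rw [hΓ, map_mul, map_pow, map_mul, aeval_X, hRr f hf, heW]
  have heP : ∀ f : Fin (2 + 1) → ℝ,
      aeval f (rename Fin.castSucc P) = aeval ![f 0, f 1] P := fun f => by
    have hfc : f ∘ Fin.castSucc = ![f 0, f 1] := by
      funext j
      fin_cases j <;> rfl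
    rw [aeval_rename, hfc]
  have heH : ∀ f : Fin (2 + 1) → ℝ, aeval f H =
      aeval f (pderiv 0 Γ) * -(f (Fin.last 2) * (f 0 * (1 - f 0)) * β) -
        aeval f (pderiv 1 Γ) * -(f (Fin.last 2) * (1 - f 0 - f 0) * (α + β * f 1)) +
        β * f (Fin.last 2) ^ (N₁ + 1) * aeval ![f 0, f 1] P := fun f => by
    simp only [hH, hQ0, hQ1, map_add, map_sub, map_mul, map_neg, aeval_X, MvPolynomial.aeval_C,
      eq_ratCast, heu, heu', heW, hec, heP]
  -- KEY FACT: `H` vanishes on the polar curve `ϖ u W = 1` (`ϖ ≠ 0`, `x ∉ {0, 1}`)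
  have hHZ : ∀ f : Fin (2 + 1) → ℝ, f (Fin.last 2) ≠ 0 → f 0 ≠ 0 → f 0 ≠ 1 →
      f 1 = ((f (Fin.last 2))⁻¹ / (f 0 * (1 - f 0)) - α) / β → aeval f H = 0 := by
    intro f ht hx0 hx1 hs
    obtain ⟨x, hx⟩ : ∃ x : ℝ, x = f 0 := ⟨_, rfl⟩
    obtain ⟨t, htf⟩ : ∃ t : ℝ, t = f (Fin.last 2) := ⟨_, rfl⟩
    rw [← hx] at hx0 hx1 hs
    rw [← htf] at ht hs
    have hux : x * (1 - x) ≠ 0 := mul_ne_zero hx0 (sub_ne_zero.2 (Ne.symm hx1))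
    obtain ⟨s₀, hs₀⟩ : ∃ s₀ : ℝ → ℝ, s₀ = fun x' => (t⁻¹ / (x' * (1 - x')) - α) / β := ⟨_, rfl⟩
    obtain ⟨γ, hγ⟩ : ∃ γ : ℝ → Fin (2 + 1) → ℝ, γ = fun x' => Fin.snoc ![x', s₀ x'] t := ⟨_, rfl⟩
    have hγ0 : ∀ x', γ x' 0 = x' := fun x' => by rw [hγ]; rfl
    have hγ1 : ∀ x', γ x' 1 = s₀ x' := fun x' => by rw [hγ]; rfl
    have hγL : ∀ x', γ x' (Fin.last 2) = t := fun x' => by rw [hγ]; exact Fin.snoc_last _ _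
    have hγx : γ x = f := by
      funext l
      refine Fin.lastCases ?_ (fun j => ?_) l
      · rw [hγL, htf]
      · fin_cases j
        · exact (hγ0 x).trans hx
        · show γ x 1 = f 1
          rw [hγ1, hs, hs₀]
    -- `W` and `Γ` along `γ`
    have hWγ : ∀ x', (α : ℝ) + β * s₀ x' = t⁻¹ / (x' * (1 - x')) := fun x' => by
      rw [hs₀]
      field_simp
      ring
    have hfun : (fun x' => aeval (γ x') Γ) =
        fun x' => t ^ N₁ * (aeval ![t⁻¹, x'] R / (x' * (1 - x')) ^ k) := by
      funext x'
      rw [heΓ (γ x') (by rw [hγL]; exact ht), hγL, hγ0, hγ1, hWγ, mul_div_assoc',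
        mul_inv_cancel₀ ht, one_div_pow, mul_assoc, mul_one_div]
    -- derivative of `s₀` and the chain rule along `γ`
    have hud : HasDerivAt (fun x' : ℝ => x' * (1 - x')) (1 * (1 - x) + x * (0 - 1)) x :=
      (hasDerivAt_id x).mul ((hasDerivAt_const x (1 : ℝ)).sub (hasDerivAt_id x))
    have hsd : HasDerivAt s₀
        (((0 * (x * (1 - x)) - t⁻¹ * (1 * (1 - x) + x * (0 - 1))) / (x * (1 - x)) ^ 2) / β) x := by
      rw [hs₀]
      exact (((hasDerivAt_const x t⁻¹).div hud hux).sub_const _).div_const _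
    obtain ⟨γ', hγ'⟩ : ∃ γ' : Fin (2 + 1) → ℝ, γ' = Fin.snoc
      ![1, ((0 * (x * (1 - x)) - t⁻¹ * (1 * (1 - x) + x * (0 - 1))) / (x * (1 - x)) ^ 2) / β] 0 :=
      ⟨_, rfl⟩
    have hγ'0 : γ' 0 = 1 := by rw [hγ']; rfl
    have hγ'1 : γ' 1 = ((0 * (x * (1 - x)) - t⁻¹ * (1 * (1 - x) + x * (0 - 1))) /
        (x * (1 - x)) ^ 2) / β := by rw [hγ']; rfl
    have hγ'L : γ' (Fin.last 2) = 0 := by rw [hγ']; exact Fin.snoc_last _ _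
    have hγd : ∀ l, HasDerivAt (fun x' => γ x' l) (γ' l) x := by
      intro l
      refine Fin.lastCases ?_ (fun j => ?_) l
      · rw [hγ'L, funext hγL]
        exact hasDerivAt_const x t
      · fin_cases j
        · show HasDerivAt (fun x' => γ x' 0) (γ' 0) x
          rw [hγ'0, funext hγ0]
          exact hasDerivAt_id x
        · show HasDerivAt (fun x' => γ x' 1) (γ' 1) x
          rw [hγ'1, funext hγ1]
          exact hsd
    have h1 := KZ.hasDerivAt_aeval_comp_real hγd Γ
    rw [hγx, Fin.sum_univ_castSucc, Fin.sum_univ_two, hγ'L, mul_zero, add_zero] at h1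
    simp only [Fin.castSucc_zero, Fin.castSucc_one, hγ'0, hγ'1, mul_one] at h1
    have h2 : HasDerivAt (fun x' => aeval (γ x') Γ)
        (t ^ N₁ * (aeval ![x, s₀ x] P / (x * (1 - x)))) x := by
      rw [hfun]
      have h := (hR t⁻¹ x hx0 hx1).const_mul (t ^ N₁)
      simp only [hs₀]
      exact h
    have h3 := h1.unique h2
    have hs1 : f 1 = s₀ x := by rw [hs, hs₀]
    rw [heH, ← hx, ← htf, hs1, hWγ x]
    have hx1' : (1 : ℝ) - x ≠ 0 := sub_ne_zero.2 (Ne.symm hx1)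
    generalize aeval f (pderiv 0 Γ) = G0 at h3 ⊢
    generalize aeval f (pderiv 1 Γ) = G1 at h3 ⊢
    generalize aeval ![x, s₀ x] P = Pv at h3 ⊢
    have h4 : G0 = t ^ N₁ * (Pv / (x * (1 - x))) - G1 * (((0 * (x * (1 - x)) -
        t⁻¹ * (1 * (1 - x) + x * (0 - 1))) / (x * (1 - x)) ^ 2) / β) := by
      linear_combination h3
    rw [h4]
    field_simp
    ring
  -- DIVISION by `Q = 1 − ϖ·(uW)` in the variable `ϖ`; the remainder vanishes
  obtain ⟨U, hU⟩ : ∃ U : MvPolynomial (Fin (2 + 1)) ℚ, U = u * W := ⟨_, rfl⟩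
  have hQU : 1 - X (Fin.last 2) * U = Qp := by rw [hQp, hU]; ring
  have hUt : ∀ (f : Fin (2 + 1) → ℝ) (t : ℝ),
      aeval (Function.update f (Fin.last 2) t) U = aeval f U := fun f t => by
    rw [hU, map_mul, map_mul, heu, heW, heu, heW, Function.update_of_ne hL0.symm,
      Function.update_of_ne hL1.symm]
  obtain ⟨N, q, Rm, hdiv, hRmt⟩ := div_rem_update (Fin.last 2) U hUt H
  have hRm0 : Rm = 0 := by
    apply MvPolynomial.map_injective (algebraMap ℚ ℝ) (algebraMap ℚ ℝ).injective
    rw [map_zero]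
    refine MvPolynomial.funext_set (![Set.Ioo 0 1, Set.Ioi 0, Set.univ] : Fin (2 + 1) → Set ℝ)
      (fun l => ?_) (fun g hg => ?_)
    · fin_cases l
      · exact Set.Ioo_infinite zero_lt_one
      · exact Set.Ioi_infinite 0
      · exact Set.infinite_univ
    · rw [MvPolynomial.eval_map, map_zero, ← MvPolynomial.aeval_def]
      have hg0 : g 0 ∈ Set.Ioo (0 : ℝ) 1 := hg 0 (Set.mem_univ _)
      have hg1 : g 1 ∈ Set.Ioi (0 : ℝ) := hg 1 (Set.mem_univ _)
      have hg00 : g 0 ≠ 0 := hg0.1.ne'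
      have hg01 : 1 - g 0 ≠ 0 := sub_ne_zero.2 hg0.2.ne'
      have hux : g 0 * (1 - g 0) ≠ 0 := mul_ne_zero hg00 hg01
      have hWg : (α : ℝ) + β * g 1 ≠ 0 := by
        have : (0 : ℝ) < β := by exact_mod_cast hβ
        have : (0 : ℝ) < g 1 := hg1
        positivity
      obtain ⟨t, ht⟩ : ∃ t : ℝ, t = (g 0 * (1 - g 0) * (α + β * g 1))⁻¹ := ⟨_, rfl⟩
      have ht0 : t ≠ 0 := by rw [ht]; exact inv_ne_zero (mul_ne_zero hux hWg)
      have hval : aeval (Function.update g (Fin.last 2) t) H = 0 := by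
        refine hHZ _ (by rwa [Function.update_self])
          (by rw [Function.update_of_ne hL0.symm]; exact hg00)
          (by rw [Function.update_of_ne hL0.symm]; exact hg0.2.ne) ?_
        rw [Function.update_self, Function.update_of_ne hL0.symm, Function.update_of_ne hL1.symm,
          ht, inv_inv]
        field_simp
        ring
      have hQv : aeval (Function.update g (Fin.last 2) t) Qp = 0 := by
        rw [heQ, Function.update_self, Function.update_of_ne hL0.symm,
          Function.update_of_ne hL1.symm, ht]
        field_simp
        ring
      have key := congrArg (aeval (Function.update g (Fin.last 2) t)) hdiv
      rw [hQU, map_add, map_mul, map_mul, hval, hQv, mul_zero, mul_zero, zero_add, hRmt] at key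
      exact key.symm
  rw [hRm0, add_zero] at hdiv
  obtain ⟨p, hp⟩ := exists_eq_mul_of_pow_mul (Fin.last 2) U H q N hdiv
  rw [hQU] at hp
  -- the CERTIFICATE: symbolic partial derivatives of the data
  have hA1 : pderiv 0 (C β * X (Fin.last 2) * u * Γ) =
      C β * X (Fin.last 2) * (u' * Γ + u * pderiv 0 Γ) := by
    rw [pderiv_mul, pderiv_mul, pderiv_mul, pderiv_C, pderiv_X_of_ne hL0, hu0]; ring
  have hA2 : pderiv 1 (-(X (Fin.last 2) * u' * W * Γ)) =
      -(X (Fin.last 2) * u' * (C β * Γ + W * pderiv 1 Γ)) := by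
    rw [map_neg, pderiv_mul, pderiv_mul, pderiv_mul, pderiv_X_of_ne hL1, hu'1, hW1]; ring
  have hD0 : pderiv 0 (c * Qp) = -(c * (X (Fin.last 2) * u' * W)) := by
    rw [pderiv_mul, hc0, hQ0]; ring
  have hD1 : pderiv 1 (c * Qp) = -(c * (X (Fin.last 2) * u * C β)) := by
    rw [pderiv_mul, hc1, hQ1]; ring
  refine ⟨3, ![0, 0, 1], ![antider p, C β * X (Fin.last 2) * u * Γ, -(X (Fin.last 2) * u' * W * Γ)],
    ![c, c * Qp, c * Qp], fun j w hw => ?_, fun w hw => ?_⟩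
  · -- the denominators `c = βϖ^{N₁+1}`, `cQ` do not vanish on the closed square at `ϖ₀`
    have hcv : aeval (Fin.snoc w ϖ₀ : Fin (2 + 1) → ℝ) c ≠ 0 := by
      rw [hec, Fin.snoc_last]
      exact mul_ne_zero hβr (pow_ne_zero _ hp0)
    have hDv : aeval (Fin.snoc w ϖ₀ : Fin (2 + 1) → ℝ) (c * Qp) ≠ 0 := by
      rw [map_mul]
      exact mul_ne_zero hcv (hQ w hw)
    fin_cases j
    · simpa using hcv
    · simpa using hDv
    · simpa using hDv
  · -- the pointwise identity on the closed square at `ϖ₀`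
    obtain ⟨f, hf⟩ : ∃ f : Fin (2 + 1) → ℝ, f = Fin.snoc w ϖ₀ := ⟨_, rfl⟩
    rw [← hf]
    have hQv : aeval f Qp ≠ 0 := by rw [hf]; exact hQ w hw
    have hv2 : f (Fin.last 2) = ϖ₀ := by rw [hf, Fin.snoc_last]
    have hHp := congrArg (aeval f) hp
    rw [map_mul, heH, hv2] at hHp
    have hcs0 : (Fin.castSucc (0 : Fin 2) : Fin (2 + 1)) = 0 := rfl
    have hcs1 : (Fin.castSucc (1 : Fin 2) : Fin (2 + 1)) = 1 := rfl
    simp only [Fin.sum_univ_three, Matrix.cons_val_zero, Matrix.cons_val_one, Matrix.cons_val_two,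
      Matrix.tail_cons, Matrix.head_cons, hcs0, hcs1]
    rw [pderiv_antider, hA1, hA2, hD0, hD1, hc0]
    simp only [map_sub, map_mul, map_neg, map_add, map_pow, MvPolynomial.aeval_C, aeval_X,
      eq_ratCast, hv2, heW, heu, heu', hec, heP, mul_zero, sub_zero]
    have hcv : (β : ℝ) * ϖ₀ ^ (N₁ + 1) ≠ 0 := mul_ne_zero hβr (pow_ne_zero _ hp0)
    generalize aeval f (pderiv 0 Γ) = G0 at hHp ⊢
    generalize aeval f (pderiv 1 Γ) = G1 at hHp ⊢
    generalize aeval f Γ = G at hHp ⊢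
    generalize aeval ![f 0, f 1] P = Pv at hHp ⊢
    generalize aeval f Qp = Qv at hHp hQv ⊢
    generalize aeval f p = pv at hHp ⊢
    have hPv : Pv = (Qv * pv - (G0 * -(ϖ₀ * (f 0 * (1 - f 0)) * β) -
        G1 * -(ϖ₀ * (1 - f 0 - f 0) * (α + β * f 1)))) / (β * ϖ₀ ^ (N₁ + 1)) := by
      rw [eq_div_iff hcv]
      linear_combination hHp
    rw [hPv]
    field_simp
    ring

end Summit.KontsevichZagierPeriods.InverseLandau.TateFamilyKernel.Descent
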